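import Literature.AnabelianGeometry.AbsoluteAnabelian.MLFGaloisTLGUnits

/-!
# The natural functor `𝒞^MLF_TLG → 𝒞^MLF_TCG` of [AbsTopIII] Definition 3.1 (iii): morphisms and the functor

S. Mochizuki, *Topics in absolute anabelian geometry III*, §3, Def. 3.1 (iii) p. 68 (bib key
`MochizukiAbsTopIII2015`; locators = kurims manuscript pages, lit key `paper:url-5493eb38cbb7`):
"… we thus obtain natural functors …; `𝒞^MLF_TLG → 𝒞^MLF_TCG` — i.e., by taking … the maximal compact
subgroups of the subgroups of the arithmetic data obtained as subgroups of invariants for various open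
subgroups of the Galois group".  Continuation of `MLFGaloisTLGUnits.lean` (objects: `tlgUnitsPair`,
intrinsic units `IsIntrinsicUnit` read through Rmk. 3.1.1 p. 70; seat abc-iut-L4-t2, sub-DAG row P32.0.r0
of `plan/L4/SUBDAG-AbsTopIII-Prop32.md`):

* MORPHISMS (Def. 3.1 (ii)): `Hom.isIntrinsicUnit_map` — a morphism `φ : P → Q` of pairs maps intrinsic
  units of `P` into those of an MLF-Galois `TLG`-pair `Q`, PROVIDED the saturations `φ_Π(U)·Ker_Q` of open
  subgroups `U ⊆ Π_P` — open in `Π_Q` by the typed "open injective homomorphism between the arithmetic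
  Galois groups" — have FINITE INDEX in `Π_Q` (`hfin`): the `ℓ^n`-th roots of `x` fixed by `Stab(x)` map
  to roots of `φ_M(x)` fixed by `φ_Π(Stab x)·Ker_Q`, which cuts out a finite extension of `k_Q` exactly
  when it has finite index (`MLFClosureCompactFixedUnits`), where Rmk. 3.1.1 applies.  `hfin` holds for
  compact `Π_Q` (`isIntrinsicUnit_map_of_compactSpace`: étale, profinite `Π` — `𝒞^{MLF-hyp}`,
  `𝒞^{MLF-sB}`) and for compact arithmetic Galois group `Π_Q/Ker_Q`
  (`isIntrinsicUnit_map_of_compactSpace_quotient`); it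
  does NOT follow from the typed axioms alone (Def. 3.1 (i) lets `Π_k` be ANY topological group with a
  continuous surjection onto `G_k`, e.g. `G_k` made discrete) — print has the same latitude and intends
  `G ≅ G_k` profinite, so the functor is typed on the full subcategory with COMPACT Galois group, which
  contains every category it is applied to in print (Prop. 3.2 (v), Cor. 3.6: `𝒞^{MLF-sB}`);
* `Hom.tlgUnits`; `MLFGaloisMonoidPairCompactCat T`; the FUNCTOR
  `tlgToTCG : MLFGaloisMonoidPairCompactCat TLG ⥤ MLFGaloisMonoidPairCat TCG`, compatible with
  `(Π ↷ M) ↦ Π` on the nose (`tlgToTCG_homPi`).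

HONEST FRAMING: OUR kernel constructions of classical objects named by a refereed 2015 paper; nothing
here bears on [IUTchIII] Cor. 3.12; typed ≠ proved for anything downstream.
-/

noncomputable section

universe u

namespace Literature.AnabelianGeometry.AbsoluteAnabelian

open _root_.CategoryTheory
open _root_.ValuativeRel
open Literature.NumberTheory.GaloisRepresentations
open scoped nonZeroDivisors

/-! ### Morphisms: a morphism of pairs maps `𝒪^×` into `𝒪^×` -/

namespace GaloisMonoidPair

variable {P Q R : GaloisMonoidPair.{u}}

/-- If `S ⊆ Π_P` fixes `y`, then the saturation `φ_Π(S)·Ker_Q` fixes `φ_M(y)` (the `GaloisMonoidPair`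
twin of `GaloisFieldPair.Hom.smul_map_eq_of_mem_sup`; private: same statement shape on a different pair
structure). [cite: MochizukiAbsTopIII2015, Definition 3.1 (ii) p.67] -/
private theorem Hom.smul_map_eq_of_mem_sup (φ : P.Hom Q) (S : Subgroup P.Pi) {y : P.M}
    (hy : ∀ g ∈ S, g • y = y) {h : Q.Pi} (hh : h ∈ S.map φ.homPi ⊔ Q.actionKer) :
    h • φ.homM y = φ.homM y := by
  have hle : S.map φ.homPi ⊔ Q.actionKer ≤ MulAction.stabilizer Q.Pi (φ.homM y) := by
    refine sup_le ?_ ?_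
    · intro h' hh'
      obtain ⟨g, hg, rfl⟩ := Subgroup.mem_map.mp hh'
      rw [MulAction.mem_stabilizer_iff, ← φ.smul_comm, hy g hg]
    · intro h' hh'
      rw [MulAction.mem_stabilizer_iff]
      exact (GaloisMonoidPair.mem_actionKer_iff Q h').mp hh' _
  exact hle hh

/-- **A morphism of pairs maps intrinsic units into intrinsic units**, for an MLF-Galois `TLG` target and
finite-index saturations `φ_Π(U)·Ker_Q` of open `U` (`hfin`, automatic for compact `Π_Q` or compact
arithmetic Galois group). [cite: MochizukiAbsTopIII2015, Definition 3.1 (iii) p.68] -/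
theorem Hom.isIntrinsicUnit_map (φ : P.Hom Q) (hQ : IsMLFGaloisMonoidPair .TLG Q)
    (hfin : ∀ U : Subgroup P.Pi, IsOpen (U : Set P.Pi) → (U.map φ.homPi ⊔ Q.actionKer).FiniteIndex)
    {x : P.M} (hx : P.IsIntrinsicUnit x) : Q.IsIntrinsicUnit (φ.homM x) := by
  obtain ⟨ℓ, hℓ, hroots⟩ := hx
  obtain ⟨C, D, Q₀, hQ₀, ⟨e⟩⟩ := hQ.exists_model
  have hQ' : D.tlgPair = Q₀ := Option.some_injective _ (D.monoidPair_TLG.symm.trans hQ₀)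
  subst hQ'
  set S : Subgroup P.Pi := MulAction.stabilizer P.Pi x with hS
  set H : Subgroup Q.Pi := S.map φ.homPi ⊔ Q.actionKer with hH
  haveI hHfin : H.FiniteIndex := hfin S (P.isOpen_stabilizer x)
  set H' : Subgroup D.tlgPair.Pi := H.comap e.isoPi.toMonoidHom with hH'
  haveI : H'.FiniteIndex := by
    rw [Subgroup.finiteIndex_iff, hH',
      Subgroup.index_comap_of_surjective _ e.isoPi.surjective]
    exact hHfin.index_ne_zero
  have hfixD : ∀ y : P.M, (∀ g ∈ S, g • y = y) →
      ∀ g ∈ H', g • e.isoM.symm (φ.homM y) = e.isoM.symm (φ.homM y) := by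
    intro y hy g hg
    apply e.isoM.injective
    rw [e.smul_comm, MulEquiv.apply_symm_apply]
    exact φ.smul_map_eq_of_mem_sup S hy (Subgroup.mem_comap.mp hg)
  have h1 : D.tlgPair.IsIntrinsicUnit (e.isoM.symm (φ.homM x)) :=
    D.tlgPair_isIntrinsicUnit_of_forall_exists_pow_eq_fixed C H' hℓ fun n => by
      obtain ⟨y, hy, hyx⟩ := hroots n
      refine ⟨e.isoM.symm (φ.homM y), hfixD y (fun g hg => hy g hg), ?_⟩
      rw [← map_pow, ← map_pow, hyx]
  have h2 := (GaloisMonoidPair.isIntrinsicUnit_iff_of_iso e _).mp h1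
  rwa [MulEquiv.apply_symm_apply] at h2

/-- `hfin` for a target with COMPACT `Π` (private twin of the `GaloisFieldPair` lemma; public form:
`isIntrinsicUnit_map_of_compactSpace`). [cite: MochizukiAbsTopIII2015, Definition 3.1 (ii) p.67] -/
private theorem Hom.finiteIndex_sat_of_compactSpace (φ : P.Hom Q) [CompactSpace Q.Pi] (U : Subgroup P.Pi)
    (hU : IsOpen (U : Set P.Pi)) : (U.map φ.homPi ⊔ Q.actionKer).FiniteIndex :=
  haveI : Finite (Q.Pi ⧸ (U.map φ.homPi ⊔ Q.actionKer)) :=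
    Subgroup.quotient_finite_of_isOpen _ (φ.isOpen_image U hU)
  Subgroup.finiteIndex_of_finite_quotient

/-- `hfin` for a target with compact ARITHMETIC GALOIS GROUP `Π_Q/Ker_Q` (private twin of the
`GaloisFieldPair` lemma; public form: `isIntrinsicUnit_map_of_compactSpace_quotient`).
[cite: MochizukiAbsTopIII2015, Definition 3.1 (ii) p.67] -/
private theorem Hom.finiteIndex_sat_of_compactSpace_quotient (φ : P.Hom Q) [CompactSpace (Q.Pi ⧸ Q.actionKer)]
    (U : Subgroup P.Pi) (hU : IsOpen (U : Set P.Pi)) : (U.map φ.homPi ⊔ Q.actionKer).FiniteIndex :=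
  haveI : Q.actionKer.Normal := by
    unfold GaloisMonoidPair.actionKer
    infer_instance
  finiteIndex_of_isOpen_of_compactSpace_quotient Q.actionKer _ le_sup_right (φ.isOpen_image U hU)

/-- **A morphism into an MLF-Galois `TLG`-pair with COMPACT Galois group maps intrinsic units to
intrinsic units** (étale, profinite `Π`: all of `𝒞^{MLF-hyp}`, `𝒞^{MLF-sB}`).
[cite: MochizukiAbsTopIII2015, Definition 3.1 (iii) p.68] -/
theorem Hom.isIntrinsicUnit_map_of_compactSpace (φ : P.Hom Q) (hQ : IsMLFGaloisMonoidPair .TLG Q)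
    [CompactSpace Q.Pi] {x : P.M} (hx : P.IsIntrinsicUnit x) : Q.IsIntrinsicUnit (φ.homM x) :=
  φ.isIntrinsicUnit_map hQ (φ.finiteIndex_sat_of_compactSpace) hx

/-- The same for a target with compact ARITHMETIC Galois group `Π_Q/Ker_Q` (quotient topology; e.g. a
tempered `Π` over a profinite `G_k`). [cite: MochizukiAbsTopIII2015, Definition 3.1 (iii) p.68] -/
theorem Hom.isIntrinsicUnit_map_of_compactSpace_quotient (φ : P.Hom Q) (hQ : IsMLFGaloisMonoidPair .TLG Q)
    [CompactSpace (Q.Pi ⧸ Q.actionKer)] {x : P.M} (hx : P.IsIntrinsicUnit x) :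
    Q.IsIntrinsicUnit (φ.homM x) :=
  φ.isIntrinsicUnit_map hQ (φ.finiteIndex_sat_of_compactSpace_quotient) hx

/-- **Def 3.1 (iii), `𝒞^MLF_TLG → 𝒞^MLF_TCG` on morphisms**: `(φ_Π, φ_M) ↦ (φ_Π, φ_M|_{𝒪^×})`.
[cite: MochizukiAbsTopIII2015, Definition 3.1 (iii) p.68] -/
def Hom.tlgUnits (φ : P.Hom Q) (hP : IsMLFGaloisMonoidPair .TLG P) (hQ : IsMLFGaloisMonoidPair .TLG Q)
    (hfin : ∀ U : Subgroup P.Pi, IsOpen (U : Set P.Pi) → (U.map φ.homPi ⊔ Q.actionKer).FiniteIndex) :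
    (P.tlgUnitsPair hP).Hom (Q.tlgUnitsPair hQ) where
  homPi := φ.homPi
  continuous_homPi := φ.continuous_homPi
  homM :=
    { toFun := fun m => ⟨φ.homM (m : P.M), φ.isIntrinsicUnit_map hQ hfin m.2⟩
      map_one' := Subtype.ext (map_one φ.homM)
      map_mul' := fun m m' => Subtype.ext (map_mul φ.homM (m : P.M) (m' : P.M)) }
  smul_comm g m := Subtype.ext (φ.smul_comm g (m : P.M))
  comap_ker := by
    rw [actionKer_tlgUnitsPair hQ, actionKer_tlgUnitsPair hP]
    exact φ.comap_ker
  isOpen_image U hU := by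
    rw [actionKer_tlgUnitsPair hQ]
    exact φ.isOpen_image U hU

/-- The Galois component of `φ.tlgUnits` is `φ_Π`. [cite: MochizukiAbsTopIII2015, Definition 3.1 (iii) p.68] -/
@[simp] theorem Hom.tlgUnits_homPi (φ : P.Hom Q) (hP hQ hfin) : (φ.tlgUnits hP hQ hfin).homPi = φ.homPi := rfl

/-- The object component of `φ.tlgUnits` on underlying elements is `φ_M`. [cite: MochizukiAbsTopIII2015, Definition 3.1 (iii) p.68] -/
@[simp] theorem Hom.tlgUnits_homM_coe (φ : P.Hom Q) (hP hQ hfin) (m : (P.tlgUnitsPair hP).M) :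
    ((φ.tlgUnits hP hQ hfin).homM m : Q.M) = φ.homM (m : P.M) := rfl

end GaloisMonoidPair

/-! ### Def 3.1 (iii): the functor `𝒞^MLF_TLG → 𝒞^MLF_TCG` on pairs with compact Galois group -/

/-- The full subcategory of `𝒞^MLF_T` (`T ∈ {TCG, TLG, TM}`) of MLF-Galois `T`-pairs with COMPACT Galois
group `Π` (contains the hyperbolic-orbicurve / strictly-Belyi-type pairs: étale `Π` is profinite).
[cite: MochizukiAbsTopIII2015, Definition 3.1 (iii) p.67] -/
def MLFGaloisMonoidPairCompactCat (T : PairType) : Type (u + 1) :=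
  ObjectProperty.FullSubcategory (fun P : GaloisMonoidPair.{u} => IsMLFGaloisMonoidPair T P ∧ CompactSpace P.Pi)

/-- The category structure (full subcategory of the category of pairs).
[cite: MochizukiAbsTopIII2015, Definition 3.1 (iii) p.67] -/
instance (T : PairType) : Category (MLFGaloisMonoidPairCompactCat.{u} T) :=
  inferInstanceAs (Category (ObjectProperty.FullSubcategory _))

/-- **Def 3.1 (iii): the natural functor `𝒞^MLF_TLG → 𝒞^MLF_TCG`, `(Π ↷ M) ↦ (Π ↷ 𝒪^×)`**, on MLF-Galois
`TLG`-pairs with compact Galois group; on morphisms `(φ_Π, φ_M) ↦ (φ_Π, φ_M|_{𝒪^×})`.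
[cite: MochizukiAbsTopIII2015, Definition 3.1 (iii) p.68] -/
def tlgToTCG : MLFGaloisMonoidPairCompactCat.{u} .TLG ⥤ MLFGaloisMonoidPairCat.{u} .TCG where
  obj P := ⟨P.obj.tlgUnitsPair P.property.1,
    GaloisMonoidPair.isMLFGaloisMonoidPair_TCG_tlgUnitsPair P.property.1⟩
  map {P Q} φ := InducedCategory.homMk
    (GaloisMonoidPair.Hom.tlgUnits (P := P.obj) (Q := Q.obj) φ.hom P.property.1 Q.property.1
      (fun U hU => by
        haveI := Q.property.2
        exact GaloisMonoidPair.Hom.finiteIndex_sat_of_compactSpace (P := P.obj) (Q := Q.obj) φ.hom U hU))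
  map_id _ := InducedCategory.Hom.ext (GaloisMonoidPair.Hom.ext rfl (MonoidHom.ext fun _ => Subtype.ext rfl))
  map_comp _ _ := InducedCategory.Hom.ext (GaloisMonoidPair.Hom.ext rfl (MonoidHom.ext fun _ => Subtype.ext rfl))

/-- `tlgToTCG` is compatible with the forgetful assignment `(Π ↷ M) ↦ Π` ON THE NOSE.
[cite: MochizukiAbsTopIII2015, Definition 3.1 (iii) p.68] -/
theorem tlgToTCG_homPi {P Q : MLFGaloisMonoidPairCompactCat.{u} .TLG} (φ : P ⟶ Q) :
    (tlgToTCG.map φ).hom.homPi = GaloisMonoidPair.Hom.homPi (P := P.obj) (Q := Q.obj) φ.hom := rfl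

end Literature.AnabelianGeometry.AbsoluteAnabelian

end
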